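import Summits.QuantumFields.BalabanUV.T4Continuum.Support.NE7K1LinStripClassSumsDeriv
import Literature.MathematicalPhysics.QuantumFieldTheory.Balaban1983to89.B4StripSumsHolder

/-!
# NE7K1LinStripClassSumsHolder — row NE7 (node U5), candidate route HOM, path H1L, cell K1-lin(s): NEEDS-ESTIMATE #E1, R-E1 TRANCHE D —
# b04's `B4StripSumsHolder` §3–§6 RE-TYPED OVER THE CLASS `S`: the HÖLDER-QUOTIENT multiplier `GHS α n σ a τ μ sv =
# (n∕|sv|_∞)^α Σ_k (PhZ_k − 1)·termDS_k` of `∂^ξ_μ(σ + aQ*Q)⁻¹Q*` (B4 (2.36) along (2.49)–(2.51)), its `n`-uniform bound (finite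
# exactly for `α < 1`), holomorphy, side periodicity, `StripRegular`, and THE DECAY OF ITS LATTICE KERNEL for every `σ ∈ S`

Lineage `b2b-balaban-t4-ne7-p2` (CRUX PROVER NE7 #2), generation 76; file 70.  Files 67 ∕ 69 re-typed `B4StripSums` ∕ `B4StripSumsDeriv` over
the class.  b04's Hölder file consumes the symbol only through the regrouped ratio's gain `‖R_k‖ ≤ 2C_R∕(1 + W_n(k))`; the Hölder
factor `holderFactor_le`, the derivative size `norm_D_le`, the signed characters `PhZ` ∕ `PhZ_tr`, the even distribution of the gain
`one_add_W_rpow_le_prod` and the residue sums `sum_prod_rpow_le` are symbol-independent and used BY NAME.  THIS FILE ([folklore]):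

* §1 `norm_RS_le_one_add_W` (`‖RS_k‖ ≤ 2CRS∕(1+W)` for EVERY `k`), **`termHS`**, **`GHS`** (b04's `termH`, `GH` with `Δ^ξ_n + m² ↦ σ`;
  the separation numerator is called `sv` here), `termH_eq_termHS ∕ GH_eq_GHS` (`rfl`).
* §2 `norm_termHS_le` (b04's five-factor chain verbatim with `R ↦ RS`, `E ↦ ES`, `C_R ↦ CRS`), **`norm_GHS_le`**:
  `‖GHS‖ ≤ boundGHS d α c C_up = c⁻¹·C_H·33·2CRS·(48ζ(s_H(α,d)))^{d+1}` — finite EXACTLY for `α < 1`.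
* §3 holomorphy, §4 side periodicity, §5 **`stripRegular_GHS`**, **`GHS_stripRegular`** (class strip), **`hkernelS_decay`**:
  `‖latticeKernel (GHS α n σ a τ μ sv) x‖ ≤ boundGHS·e^{−κ_S|x|_∞}` for EVERY `σ ∈ S(n; r, C_S, C_up)`, `a ∈ [a₋,a₊]`, `τ`, `μ`,
  `sv ≠ 0` with `|sv_ν| ≤ n`, `0 ≤ α < 1`, `x ∈ ℤ^{d+1}` — B4 (2.36) over the class, constants in `(d, α, a₋, a₊, r, C_up)` ALONE.

HONEST FRAMING: [folklore]; b04's bookkeeping with one symbol letter generalised; multiplier-level statements (dictionary with the kernel's Hölder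
quotient as in b04's `GH` docstring and `B4Green242Bridge`, not re-derived); separations `|x − x′|_∞ ≤ 1` (larger ones follow from the
second quantity by the triangle inequality, as in b04); nothing of Bałaban's asserted; no `sorry`.  Census only; NE7 NOT PRINTED ∕ NOT PROVED;
spine 0∕9; FIXED FINITE T⁴, rung (B)+1; NOT infinite volume, NOT mass gap, NOT Clay.  HONEST DEPENDENCY: continuum YM on T⁴ ⇐ BetaPertH ∧ nine
spine estimates (0/9 proved); BetaPertH ⇐ (D1) ∧ (D4) ∧ CAP+tail; G-an2-4 gates asym, D1 and NE2/3/4.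
-/

noncomputable section

open Finset Complex Set

namespace Summit.QuantumFields.BalabanUV.T4Continuum.NE7K1LinStripClassSumsHolder

open Literature.MathematicalPhysics.QuantumFieldTheory.Balaban1983to89
open Literature.MathematicalPhysics.QuantumFieldTheory.Balaban1983to89.B4Strip
open Literature.MathematicalPhysics.QuantumFieldTheory.Balaban1983to89.B4StripCauchy
open Literature.MathematicalPhysics.QuantumFieldTheory.Balaban1983to89.B4StripSums
open Literature.MathematicalPhysics.QuantumFieldTheory.Balaban1983to89.B4StripSumsDeriv
open Literature.MathematicalPhysics.QuantumFieldTheory.Balaban1983to89.B4StripSumsHolder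
open Literature.MathematicalPhysics.QuantumFieldTheory.Balaban1983to89.B5Strip145Analytic
open Literature.MathematicalPhysics.QuantumFieldTheory.Balaban1983to89.B5Strip145Decay
open Literature.MathematicalPhysics.QuantumFieldTheory.Balaban1983to89.B4ContourShift
open NE7K1LinStripClass NE7K1LinStripClassCauchy NE7K1LinStripClassSums NE7K1LinStripClassSumsDeriv

variable {d : ℕ}

/-! ### §1 The Hölder-quotient multiplier over the class -/

/-- one Hölder-weighted term over the class: `(PhZ_k − 1)·termDS_k`. [folklore] -/
def termHS (n : ℕ) [NeZero n] (σ : (Fin d → ℂ) → ℂ) (a : ℝ) (τ : Fin d → Fin n) (μ : Fin d) (sv : Fin d → ℤ)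
    (k : Fin d → Fin n) (p : Fin d → ℂ) : ℂ :=
  (PhZ n k sv p - 1) * termDS n σ a τ μ k p

/-- THE FOURIER MULTIPLIER OF THE HÖLDER QUOTIENT OF `∂^ξ_μ(σ + aQ*Q)⁻¹Q*` over the class (b04's `GH` with `Δ^ξ_n + m² ↦ σ`; separation
numerator `sv`, `x′ = x + sv∕n`). [folklore] -/
def GHS (α : ℝ) (n : ℕ) [NeZero n] (σ : (Fin (d + 1) → ℂ) → ℂ) (a : ℝ) (τ : Fin (d + 1) → Fin n) (μ : Fin (d + 1))
    (sv : Fin (d + 1) → ℤ) (p : Fin (d + 1) → ℂ) : ℂ :=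
  ((((n : ℝ) / supNorm sv) ^ α : ℝ) : ℂ) * ∑ k : Fin (d + 1) → Fin n, termHS n σ a τ μ sv k p

/-- b04's Hölder term IS the class one at the block Laplacian. [folklore] -/
theorem termH_eq_termHS (n : ℕ) [NeZero n] (a m2 : ℝ) (τ : Fin d → Fin n) (μ : Fin d) (sv : Fin d → ℤ) (k : Fin d → Fin n)
    (p : Fin d → ℂ) : termH n a m2 τ μ sv k p = termHS n (DeltaXi n m2) a τ μ sv k p := rfl

/-- b04's Hölder multiplier IS the class one at the block Laplacian. [folklore] -/
theorem GH_eq_GHS (α : ℝ) (n : ℕ) [NeZero n] (a m2 : ℝ) (τ : Fin (d + 1) → Fin n) (μ : Fin (d + 1)) (sv : Fin (d + 1) → ℤ)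
    (p : Fin (d + 1) → ℂ) : GH α n a m2 τ μ sv p = GHS α n (DeltaXi n m2) a τ μ sv p := rfl

variable {n : ℕ} {σ : (Fin (d + 1) → ℂ) → ℂ} {r CS Cup : ℝ}

/-- `‖RS_k‖ ≤ 2CRS∕(1 + W_n(k))` on the fat region for EVERY `k` (the quadratic gain without a case split; b04's `norm_R_le_one_add_W`
over the class). [folklore] -/
theorem norm_RS_le_one_add_W [NeZero n] (h : SymbS n σ r CS Cup) {q : Fin (d + 1) → ℂ} (hq : q ∈ Fat (d + 1) r)
    (k : Fin (d + 1) → Fin n) : ‖RS n σ k q‖ ≤ 2 * CRS Cup / (1 + W n k) := by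
  have hC := h.cup_nonneg
  have hCR1 : 1 ≤ CRS Cup := by unfold CRS; linarith
  by_cases hk : k = fun _ => 0
  · subst hk
    rw [W_zero]
    unfold RS
    rw [if_pos rfl, norm_one]
    norm_num; linarith
  · have hW1 := one_le_W n k hk
    have h1 := norm_RS_le h hq k hk
    have hACR : 4 * Cup ≤ CRS Cup := by unfold CRS; linarith
    calc ‖RS n σ k q‖ ≤ 4 * Cup / W n k := h1
      _ ≤ 2 * CRS Cup / (1 + W n k) := by
          rw [div_le_div_iff₀ (by linarith) (by linarith)]
          nlinarith [mul_le_mul_of_nonneg_right hACR (by linarith : (0 : ℝ) ≤ W n k),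
            mul_nonneg (by linarith : (0:ℝ) ≤ 4 * Cup) (by linarith : (0 : ℝ) ≤ W n k - 1)]

/-! ### §2 The `n`-uniform bound on the fat region -/

/-- **THE BOUND OF ONE HÖLDER-WEIGHTED TERM over the class** on the fat region where `‖ES‖ ≥ c > 0`, `sv ≠ 0`, `|sv_ν| ≤ n`, `0 ≤ α ≤ 1`:
`(n∕|sv|_∞)^α‖termHS_k‖ ≤ c⁻¹·C_H·33·2CRS·Π_ν 24ω_n(k_ν)^{−s_H(α,d)}` (b04's chain with `R ↦ RS`, `E ↦ ES`). [folklore] -/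
theorem norm_termHS_le [NeZero n] (h : SymbS n σ r CS Cup) (a : ℝ) {p : Fin (d + 1) → ℂ} (hp : p ∈ Fat (d + 1) r) {c : ℝ}
    (hc : 0 < c) (hE : c ≤ ‖ES n σ a p‖) (τ : Fin (d + 1) → Fin n) (μ : Fin (d + 1)) {sv : Fin (d + 1) → ℤ}
    (hσ0 : sv ≠ 0) (hσn : ∀ ν, |sv ν| ≤ n) {α : ℝ} (hα0 : 0 ≤ α) (hα1 : α ≤ 1) (k : Fin (d + 1) → Fin n) :
    ((n : ℝ) / supNorm sv) ^ α * ‖termHS n σ a τ μ sv k p‖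
      ≤ c⁻¹ * (CH d * 33 * (2 * CRS Cup)) * ∏ ν, 24 * omega n (k ν) ^ (-(sH α d)) := by
  have hP1 : 1 ≤ 1 + W n k := by have := W_nonneg n k; linarith
  have hP0 : 0 < 1 + W n k := by linarith
  have hCR := CRS_nonneg h.cup_nonneg
  have hCH := CH_nonneg d
  -- the five factors
  have hH := holderFactor_le n k hσ0 hσn hα0 hα1 h.r_le hp
  have hDle : ‖D n (k μ : ℕ) (p μ)‖ ≤ 33 * Real.sqrt (1 + W n k) :=
    (norm_D_le n (k μ) (NeZero.ne n) (k μ).isLt (by linarith [(hp μ).1, h.r_le]) (by linarith [(hp μ).2, h.r_le])).trans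
      (mul_le_mul_of_nonneg_left (omega_le_sqrt n k μ) (by norm_num))
  have hF := norm_F_le n h.r_le τ k hp
  have hR := norm_RS_le_one_add_W h hp k
  have hE' : ‖ES n σ a p‖⁻¹ ≤ c⁻¹ := inv_anti₀ hc hE
  have hprodF0 : 0 ≤ ∏ ν, 24 / omega n (k ν) :=
    Finset.prod_nonneg (fun ν _ => div_nonneg (by norm_num) (omega_pos n _ (k ν).isLt).le)
  have hR0' : 0 ≤ 2 * CRS Cup / (1 + W n k) := div_nonneg (by linarith) hP0.le
  have hsplit_norm : ‖termHS n σ a τ μ sv k p‖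
      = ‖PhZ n k sv p - 1‖ * (‖D n (k μ : ℕ) (p μ)‖ * (‖F n τ k p‖ * ‖RS n σ k p‖ * ‖ES n σ a p‖⁻¹)) := by
    unfold termHS termDS termS
    rw [norm_mul, norm_mul, norm_div, norm_mul, div_eq_mul_inv]
  have step1 : ((n : ℝ) / supNorm sv) ^ α * ‖termHS n σ a τ μ sv k p‖
      ≤ (CH d * (1 + W n k) ^ (α / 2)) * ((33 * Real.sqrt (1 + W n k))
          * ((∏ ν, 24 / omega n (k ν)) * (2 * CRS Cup / (1 + W n k)) * c⁻¹)) := by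
    rw [hsplit_norm, ← mul_assoc]
    have hin : ‖F n τ k p‖ * ‖RS n σ k p‖ * ‖ES n σ a p‖⁻¹
        ≤ (∏ ν, 24 / omega n (k ν)) * (2 * CRS Cup / (1 + W n k)) * c⁻¹ :=
      mul_le_mul (mul_le_mul hF hR (norm_nonneg _) hprodF0) hE' (inv_nonneg.mpr (norm_nonneg _))
        (mul_nonneg hprodF0 hR0')
    have hmid : ‖D n (k μ : ℕ) (p μ)‖ * (‖F n τ k p‖ * ‖RS n σ k p‖ * ‖ES n σ a p‖⁻¹)
        ≤ (33 * Real.sqrt (1 + W n k)) * ((∏ ν, 24 / omega n (k ν)) * (2 * CRS Cup / (1 + W n k)) * c⁻¹) :=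
      mul_le_mul hDle hin (by positivity) (by positivity)
    exact mul_le_mul hH hmid (by positivity) (mul_nonneg hCH (Real.rpow_nonneg hP0.le _))
  have halg : (1 + W n k) ^ (α / 2) * Real.sqrt (1 + W n k) / (1 + W n k) = (1 + W n k) ^ (-((1 - α) / 2)) := by
    rw [Real.sqrt_eq_rpow, ← Real.rpow_add hP0, div_eq_mul_inv, ← Real.rpow_neg_one (1 + W n k),
      ← Real.rpow_add hP0]
    congr 1; ring
  have hgain : (1 + W n k) ^ (-((1 - α) / 2)) ≤ ∏ ν, omega n (k ν) ^ (-(2 * ((1 - α) / 2) / ((d : ℝ) + 1))) :=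
    one_add_W_rpow_le_prod n k (by linarith)
  have step2 : (CH d * (1 + W n k) ^ (α / 2)) * ((33 * Real.sqrt (1 + W n k))
          * ((∏ ν, 24 / omega n (k ν)) * (2 * CRS Cup / (1 + W n k)) * c⁻¹))
      = c⁻¹ * (CH d * 33 * (2 * CRS Cup))
          * (((1 + W n k) ^ (α / 2) * Real.sqrt (1 + W n k) / (1 + W n k)) * ∏ ν, 24 / omega n (k ν)) := by
    field_simp
  have hfac : (∏ ν, omega n (k ν) ^ (-(2 * ((1 - α) / 2) / ((d : ℝ) + 1)))) * ∏ ν, 24 / omega n (k ν)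
      = ∏ ν, 24 * omega n (k ν) ^ (-(sH α d)) := by
    rw [← Finset.prod_mul_distrib]
    refine Finset.prod_congr rfl (fun ν _ => ?_)
    have hω := omega_pos n _ (k ν).isLt
    have h24 : (24 : ℝ) / omega n (k ν) = 24 * omega n (k ν) ^ (-1 : ℝ) := by
      rw [Real.rpow_neg_one, div_eq_mul_inv]
    rw [h24, show omega n (k ν) ^ (-(2 * ((1 - α) / 2) / ((d : ℝ) + 1)))
        * (24 * omega n (k ν) ^ (-1 : ℝ)) = 24 * (omega n (k ν) ^ (-(2 * ((1 - α) / 2) / ((d : ℝ) + 1)))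
        * omega n (k ν) ^ (-1 : ℝ)) by ring, ← Real.rpow_add hω]
    congr 2
    unfold sH
    field_simp
    ring
  calc ((n : ℝ) / supNorm sv) ^ α * ‖termHS n σ a τ μ sv k p‖
      ≤ c⁻¹ * (CH d * 33 * (2 * CRS Cup))
          * (((1 + W n k) ^ (α / 2) * Real.sqrt (1 + W n k) / (1 + W n k)) * ∏ ν, 24 / omega n (k ν)) := by
        rw [← step2]; exact step1
    _ = c⁻¹ * (CH d * 33 * (2 * CRS Cup)) * ((1 + W n k) ^ (-((1 - α) / 2)) * ∏ ν, 24 / omega n (k ν)) := by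
        rw [halg]
    _ ≤ c⁻¹ * (CH d * 33 * (2 * CRS Cup))
          * ((∏ ν, omega n (k ν) ^ (-(2 * ((1 - α) / 2) / ((d : ℝ) + 1)))) * ∏ ν, 24 / omega n (k ν)) := by
        apply mul_le_mul_of_nonneg_left (mul_le_mul_of_nonneg_right hgain hprodF0)
        positivity
    _ = c⁻¹ * (CH d * 33 * (2 * CRS Cup)) * ∏ ν, 24 * omega n (k ν) ^ (-(sH α d)) := by rw [hfac]

/-- the uniform bound `boundGHS d α c C_up = c⁻¹·C_H(d)·33·2CRS(C_up)·(48ζ(s_H(α,d)))^{d+1}`. [folklore] -/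
def boundGHS (d : ℕ) (α c Cup : ℝ) : ℝ := c⁻¹ * (CH d * 33 * (2 * CRS Cup)) * (48 * zetaS (sH α d)) ^ (d + 1)

/-- `boundGHS ≥ 0`. [folklore] -/
theorem boundGHS_nonneg (d : ℕ) (α : ℝ) {c Cup : ℝ} (hc : 0 < c) (hC : 0 ≤ Cup) : 0 ≤ boundGHS d α c Cup := by
  unfold boundGHS
  have := CRS_nonneg hC
  have := zetaS_nonneg (sH α d)
  have := CH_nonneg d
  positivity

/-- **THE UNIFORM BOUND OF THE CLASS HÖLDER MULTIPLIER ON THE FAT REGION**: where `‖ES(p′)‖ ≥ c > 0`, `sv ≠ 0`, `|sv_ν| ≤ n`, `0 ≤ α < 1`: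
`‖GHS α n σ a τ μ sv p′‖ ≤ boundGHS d α c C_up` — independent of `n`, `τ`, `μ`, `sv`, `a`, `σ` beyond `C_up`. [folklore] -/
theorem norm_GHS_le [NeZero n] (h : SymbS n σ r CS Cup) (a : ℝ) {p : Fin (d + 1) → ℂ} (hp : p ∈ Fat (d + 1) r) {c : ℝ}
    (hc : 0 < c) (hE : c ≤ ‖ES n σ a p‖) (τ : Fin (d + 1) → Fin n) (μ : Fin (d + 1)) {sv : Fin (d + 1) → ℤ}
    (hσ0 : sv ≠ 0) (hσn : ∀ ν, |sv ν| ≤ n) {α : ℝ} (hα0 : 0 ≤ α) (hα1 : α < 1) :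
    ‖GHS α n σ a τ μ sv p‖ ≤ boundGHS d α c Cup := by
  unfold GHS boundGHS
  have hρ : 0 ≤ ((n : ℝ) / supNorm sv) ^ α :=
    Real.rpow_nonneg (div_nonneg (Nat.cast_nonneg n) (supNorm_nonneg sv)) _
  rw [norm_mul, Complex.norm_real, Real.norm_of_nonneg hρ]
  have hCR := CRS_nonneg h.cup_nonneg
  have hCH := CH_nonneg d
  have hK : 0 ≤ c⁻¹ * (CH d * 33 * (2 * CRS Cup)) := by positivity
  calc ((n : ℝ) / supNorm sv) ^ α * ‖∑ k : Fin (d + 1) → Fin n, termHS n σ a τ μ sv k p‖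
      ≤ ((n : ℝ) / supNorm sv) ^ α * ∑ k : Fin (d + 1) → Fin n, ‖termHS n σ a τ μ sv k p‖ :=
        mul_le_mul_of_nonneg_left (norm_sum_le _ _) hρ
    _ = ∑ k : Fin (d + 1) → Fin n, ((n : ℝ) / supNorm sv) ^ α * ‖termHS n σ a τ μ sv k p‖ := by rw [Finset.mul_sum]
    _ ≤ ∑ k : Fin (d + 1) → Fin n, c⁻¹ * (CH d * 33 * (2 * CRS Cup)) * ∏ ν, 24 * omega n (k ν) ^ (-(sH α d)) :=
        Finset.sum_le_sum (fun k _ => norm_termHS_le h a hp hc hE τ μ hσ0 hσn hα0 hα1.le k)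
    _ = c⁻¹ * (CH d * 33 * (2 * CRS Cup)) * ∑ k : Fin (d + 1) → Fin n, ∏ ν, 24 * omega n (k ν) ^ (-(sH α d)) := by
        rw [Finset.mul_sum]
    _ ≤ c⁻¹ * (CH d * 33 * (2 * CRS Cup)) * (48 * zetaS (sH α d)) ^ (d + 1) :=
        mul_le_mul_of_nonneg_left (sum_prod_rpow_le n (d + 1) (one_lt_sH hα1 d)) hK

/-! ### §3 Joint holomorphy on the fat region -/

/-- one Hölder-weighted term is holomorphic at every fat point where `ES ≠ 0`. [folklore] -/
theorem differentiableAt_termHS [NeZero n] (h : SymbS n σ r CS Cup) (a : ℝ) {q : Fin (d + 1) → ℂ} (hq : q ∈ Fat (d + 1) r)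
    (hE : ES n σ a q ≠ 0) (τ : Fin (d + 1) → Fin n) (μ : Fin (d + 1)) (sv : Fin (d + 1) → ℤ) (k : Fin (d + 1) → Fin n) :
    DifferentiableAt ℂ (termHS n σ a τ μ sv k) q := by
  show DifferentiableAt ℂ (fun p => (PhZ n k sv p - 1) * termDS n σ a τ μ k p) q
  exact ((differentiableAt_PhZ n k sv q).sub (differentiableAt_const _)).mul (differentiableAt_termDS h a hq hE τ μ k)

/-- **the class Hölder multiplier is holomorphic at every fat point where `ES ≠ 0`.** [folklore] -/
theorem differentiableAt_GHS [NeZero n] (h : SymbS n σ r CS Cup) (a : ℝ) {q : Fin (d + 1) → ℂ} (hq : q ∈ Fat (d + 1) r)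
    (hE : ES n σ a q ≠ 0) (τ : Fin (d + 1) → Fin n) (μ : Fin (d + 1)) (sv : Fin (d + 1) → ℤ) (α : ℝ) :
    DifferentiableAt ℂ (GHS α n σ a τ μ sv) q := by
  show DifferentiableAt ℂ (fun p => ((((n : ℝ) / supNorm sv) ^ α : ℝ) : ℂ)
    * ∑ k : Fin (d + 1) → Fin n, termHS n σ a τ μ sv k p) q
  apply DifferentiableAt.const_mul
  apply DifferentiableAt.fun_sum
  intro k _
  exact differentiableAt_termHS h a hq hE τ μ sv k

/-! ### §4 Periodicity across the sides of the strip -/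

/-- side periodicity of one Hölder-weighted term over the class. [folklore] -/
theorem termHS_tr_side [NeZero n] (h : SymbS n σ r CS Cup) (a : ℝ) {κ : ℝ} (hκ : κ ≤ 2 * r) {p : Fin (d + 1) → ℂ}
    (hp : p ∈ Strip (d + 1) κ) (μ' : Fin (d + 1)) (hre : (p μ').re = -Real.pi) (hE0 : ES n σ a p ≠ 0)
    (hE1 : ES n σ a (tr p μ') ≠ 0) (τ : Fin (d + 1) → Fin n) (μ : Fin (d + 1)) (sv : Fin (d + 1) → ℤ)
    (k : Fin (d + 1) → Fin n) : termHS n σ a τ μ sv k (tr p μ') = termHS n σ a τ μ sv (sigma n μ' k) p := by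
  unfold termHS
  rw [PhZ_tr, termDS_tr_side h a hκ hp μ' hre hE0 hE1 τ μ k]

/-- **SIDE PERIODICITY OF THE CLASS HÖLDER MULTIPLIER**: `GHS(p + 2πe_{μ′}) = GHS(p)` at the strip points with `Re p_{μ′} = −π`. [folklore] -/
theorem GHS_tr_side [NeZero n] (h : SymbS n σ r CS Cup) (a : ℝ) {κ : ℝ} (hκ : κ ≤ 2 * r) {p : Fin (d + 1) → ℂ}
    (hp : p ∈ Strip (d + 1) κ) (μ' : Fin (d + 1)) (hre : (p μ').re = -Real.pi) (hE0 : ES n σ a p ≠ 0)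
    (hE1 : ES n σ a (tr p μ') ≠ 0) (τ : Fin (d + 1) → Fin n) (μ : Fin (d + 1)) (sv : Fin (d + 1) → ℤ) (α : ℝ) :
    GHS α n σ a τ μ sv (tr p μ') = GHS α n σ a τ μ sv p := by
  unfold GHS
  congr 1
  calc ∑ k : Fin (d + 1) → Fin n, termHS n σ a τ μ sv k (tr p μ')
      = ∑ k : Fin (d + 1) → Fin n, termHS n σ a τ μ sv (sigma n μ' k) p :=
        Finset.sum_congr rfl (fun k _ => termHS_tr_side h a hκ hp μ' hre hE0 hE1 τ μ sv k)
    _ = ∑ k : Fin (d + 1) → Fin n, termHS n σ a τ μ sv k p :=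
        Equiv.sum_comp (sigmaEquiv n μ') (fun k => termHS n σ a τ μ sv k p)

/-! ### §5 Strip regularity and the decay of the Hölder quotient's lattice kernel -/

/-- **STRIP REGULARITY OF THE CLASS HÖLDER MULTIPLIER** on any strip `Strip (d+1) κ`, `0 ≤ κ ≤ r`, where `‖ES‖ ≥ c > 0` (`sv ≠ 0`,
`|sv_ν| ≤ n`, `0 ≤ α < 1`), bound `boundGHS d α c C_up`. [folklore] -/
theorem stripRegular_GHS [NeZero n] (h : SymbS n σ r CS Cup) (a : ℝ) (τ : Fin (d + 1) → Fin n) (μ : Fin (d + 1))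
    {sv : Fin (d + 1) → ℤ} (hσ0 : sv ≠ 0) (hσn : ∀ ν, |sv ν| ≤ n) {α : ℝ} (hα0 : 0 ≤ α) (hα1 : α < 1)
    {κ c : ℝ} (hκ0 : 0 ≤ κ) (hκr : κ ≤ r) (hc : 0 < c) (hE : ∀ p ∈ Strip (d + 1) κ, c ≤ ‖ES n σ a p‖) :
    StripRegular (d := d) (GHS α n σ a τ μ sv) κ (boundGHS d α c Cup) := by
  have hfat : Strip (d + 1) κ ⊆ Fat (d + 1) r := strip_subset_fat h.r_pos.le hκr
  have hκ2 : κ ≤ 2 * r := by linarith [h.r_pos]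
  have hne : ∀ p ∈ Strip (d + 1) κ, ES n σ a p ≠ 0 := by
    intro p hp e
    have := hE p hp
    rw [e, norm_zero] at this
    linarith
  have hdiffAt : ∀ p ∈ Strip (d + 1) κ, DifferentiableAt ℂ (GHS α n σ a τ μ sv) p := fun p hp =>
    differentiableAt_GHS h a (hfat hp) (hne p hp) τ μ sv α
  refine ⟨?_, ?_, ?_, ?_⟩
  · exact fun p hp => (hdiffAt p hp).continuousAt.continuousWithinAt
  · intro i q hq z hz
    have hP : i.insertNth z (ofRealVec q) ∈ Strip (d + 1) κ :=
      insertNth_mem_Strip hκ0 i hq (openRect_subset_closedRect κ hz)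
    exact ((hdiffAt _ hP).comp z (differentiableAt_insertNth i _ z)).differentiableWithinAt
  · intro i q hq y hy
    obtain ⟨hP, hre⟩ := insertNth_left_mem hκ0 i hq hy
    rw [← tr_insertNth_left]
    have hP' := tr_mem_Strip hP i hre
    exact (GHS_tr_side h a hκ2 hP i hre (hne _ hP) (hne _ hP') τ μ sv α).symm
  · intro p hp
    exact norm_GHS_le h a (hfat hp) hc (hE p hp) τ μ hσ0 hσn hα0 hα1

/-- **THE CLASS HÖLDER MULTIPLIER ON THE CLASS STRIP**: `StripRegular (GHS α n σ a τ μ sv) κ_S (boundGHS d α (cS (d+1) a₋) C_up)`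
for every `σ ∈ S`, `a ∈ [a₋,a₊]`, `τ`, `μ`, admissible `sv`, `0 ≤ α < 1`. [folklore] -/
theorem GHS_stripRegular [NeZero n] (h : SymbS n σ r CS Cup) {aminus aplus a : ℝ} (ha : 0 < aminus) (ha1 : aminus ≤ a)
    (ha2 : a ≤ aplus) (τ : Fin (d + 1) → Fin n) (μ : Fin (d + 1)) {sv : Fin (d + 1) → ℤ} (hσ0 : sv ≠ 0)
    (hσn : ∀ ν, |sv ν| ≤ n) {α : ℝ} (hα0 : 0 ≤ α) (hα1 : α < 1) :
    StripRegular (d := d) (GHS α n σ a τ μ sv) (kappaS (d + 1) aminus aplus Cup r)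
      (boundGHS d α (cS (d + 1) aminus) Cup) :=
  stripRegular_GHS h a τ μ hσ0 hσn hα0 hα1 (kappaS_pos (d + 1) ha h.cup_nonneg h.r_pos).le
    (kappaS_le (d + 1) aminus aplus Cup r) (cS_pos (d + 1) ha) (uniformStrip h ha ha1 ha2)

/-- **B4 (2.36) OVER THE CLASS — THE DECAY OF THE LATTICE KERNEL OF THE HÖLDER QUOTIENT'S MULTIPLIER**: for `0 < a₋ ≤ a ≤ a₊`,
`0 ≤ α < 1`, EVERY `n ≥ 1`, EVERY `σ ∈ S(n; r, C_S, C_up)`, every `τ`, `μ`, `sv ≠ 0` with `|sv_ν| ≤ n`, and every `x ∈ ℤ^{d+1}`: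
`‖latticeKernel (GHS α n σ a τ μ sv) x‖ ≤ boundGHS·e^{−κ_S|x|_∞}` — constants functions of `(d, α, a₋, a₊, r, C_up)` ALONE. [folklore] -/
theorem hkernelS_decay [NeZero n] (h : SymbS n σ r CS Cup) {aminus aplus a : ℝ} (ha : 0 < aminus) (ha1 : aminus ≤ a)
    (ha2 : a ≤ aplus) (τ : Fin (d + 1) → Fin n) (μ : Fin (d + 1)) {sv : Fin (d + 1) → ℤ} (hσ0 : sv ≠ 0)
    (hσn : ∀ ν, |sv ν| ≤ n) {α : ℝ} (hα0 : 0 ≤ α) (hα1 : α < 1) (x : Fin (d + 1) → ℤ) :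
    ‖latticeKernel (GHS α n σ a τ μ sv) x‖
      ≤ boundGHS d α (cS (d + 1) aminus) Cup * Real.exp (-(kappaS (d + 1) aminus aplus Cup r * supNorm x)) :=
  latticeKernel_decay (GHS_stripRegular h ha ha1 ha2 τ μ hσ0 hσn hα0 hα1) (kappaS_pos (d + 1) ha h.cup_nonneg h.r_pos).le x

end Summit.QuantumFields.BalabanUV.T4Continuum.NE7K1LinStripClassSumsHolder

end
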